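import Summits.ValiantsHypothesis.ValiantsHypothesis.Theses.BorderApolarity
import Literature.Computability.AlgebraicComplexity.Apolarity
import Literature.Computability.AlgebraicComplexity.StandardFamiliesProofs

/-!
# `WitnessToMembership` (route BorderApolarity, stmt-ValiantsHypothesis-5782) — proof

CANDIDATE PROOF prepared by the crux disprover (refuter-cdisprove-stmt-ValiantsHypothesis-5778-g2-0);
refuters cannot land positive files, so a prover may land this verbatim as
`Summits/ValiantsHypothesis/ValiantsHypothesis/Theorems/BorderApolarityWitnessToMembership.lean`
(`ledger propose --kind proof --workitem stmt-ValiantsHypothesis-5782`).  Sorry-free; axioms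
propext / Classical.choice / Quot.sound (`lean check --axioms`).

Statement: for `n ≤ m`, a border-apolar witness (P•, J) as in crux `FixedWitnessObstructionQP`
forces `X₀₀^{m−n} per_n ∈ Δ(det_m)`.  Only W1 (orbit), W3 (limsup clause) in degree `m` and W5
(apolarity) in degree `m` are used; `3 ≤ n`, W2 and W4 are not.

Proof: (1) top-degree pairing `D ⌟ g = C(Σ_d D_d g_d d!)` for forms of equal degree
(`apolarAction_eq_C`); (2) the weighted coefficient vectors `w_t = (P_t)_d·d!` normalised to the unit
sup-sphere of the finite-dimensional space `{d // |d| = m} → ℂ` have a convergent subsequence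
`v_{φ t} → u` (`IsCompact.tendsto_subseq`); (3) for a form `D` with `L_u(D) = 0` the corrected forms
`κ⁻¹((L_{v_{φt}} E) D − (L_{v_{φt}} D) E)`, `E = Σ conj(u_d) x^d`, `κ = Σ|u_d|²`, annihilate `P_{φ t}`
and converge to `D`, so `D ∈ J_m` by W3 and `D ⌟ pp = 0` by W5 (`mem_of_L_eq_zero`); (4) hence the
functional of `pp` vanishes on `ker L_u`, so `w_pp = μ u`, `μ ≠ 0` (`exists_smul_of_ker_le`,
`paddedPerPoly_ne_zero`); (5) then `c_t P_{φ t} → pp` coefficientwise with `c_t = μ/‖w_{φt}‖ ≠ 0`,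
and `c_t P_{φt} ∈ GL·det_m` because the orbit is a cone (row scaling, `smul_mem_glOrbit_detPoly`);
(6) Euclidean limits of orbit points lie in the Zariski orbit closure since test polynomials are
continuous in the product topology (`mem_orbitClosure_of_tendsto`).
-/

namespace Summit.ValiantsHypothesis.ValiantsHypothesis.Theorems.BorderApolarityWitnessToMembership

open Literature.Computability.AlgebraicComplexity
open Summit.ValiantsHypothesis.ValiantsHypothesis.Theses.BorderApolarity
open Filter MvPolynomial
open scoped Matrix BigOperators Topology ComplexConjugate

set_option linter.dupNamespace false
set_option linter.unusedSectionVars false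

noncomputable section

variable {σ : Type*}

/-! ## 1. The top-degree pairing -/

/-- `d! := ∏_{i ∈ supp d} (d i)!` as a complex number. -/
def fact (d : σ →₀ ℕ) : ℂ := ∏ i ∈ d.support, ((d i).factorial : ℂ)

theorem fact_ne_zero (d : σ →₀ ℕ) : fact d ≠ 0 := by
  unfold fact
  rw [Finset.prod_ne_zero_iff]
  intro i _
  exact_mod_cast (d i).factorial_ne_zero

/-- Two exponents of the same degree with `e ≤ d` are equal. -/
theorem eq_of_le_of_degree_eq {e d : σ →₀ ℕ} (h : e ≤ d) (hdeg : e.degree = d.degree) : e = d := by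
  have h1 : e + (d - e) = d := add_tsub_cancel_of_le h
  have h2 : (d - e).degree = 0 := by
    have := congrArg Finsupp.degree h1
    rw [map_add] at this
    omega
  rw [Finsupp.degree_eq_zero_iff] at h2
  rw [h2, add_zero] at h1
  exact h1

/-- **Top-degree pairing.** For `D, g` homogeneous of the same degree `m`,
`D ⌟ g = C (Σ_{d ∈ supp D} D_d g_d d!)`. [folklore] -/
theorem apolarAction_eq_C [DecidableEq σ] {D g : MvPolynomial σ ℂ} {m : ℕ}
    (hD : D.IsHomogeneous m) (hg : g.IsHomogeneous m) :
    apolarAction D g = C (∑ d ∈ D.support, coeff d D * coeff d g * fact d) := by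
  classical
  rw [apolarAction_def, map_sum]
  refine Finset.sum_congr rfl fun e he => ?_
  have hedeg : e.degree = m := by
    rw [Finsupp.degree_eq_weight_one]; exact hD (mem_support_iff.1 he)
  -- inner sum collapses to the `d = e` term
  rw [Finset.sum_eq_single e]
  · -- d = e
    have hprod : (∏ i ∈ e.support, (Nat.descFactorial (e i) (e i) : ℂ)) = fact e := by
      unfold fact
      refine Finset.prod_congr rfl fun i _ => ?_
      rw [Nat.descFactorial_self]
    rw [tsub_self, hprod]
    rfl
  · intro d hd hne
    have hddeg : d.degree = m := by
      rw [Finsupp.degree_eq_weight_one]; exact hg (mem_support_iff.1 hd)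
    have hnle : ¬ e ≤ d := fun hle => hne (eq_of_le_of_degree_eq hle (hedeg.trans hddeg.symm)).symm
    obtain ⟨i, hi⟩ : ∃ i, d i < e i := by
      by_contra hcon
      push Not at hcon
      exact hnle fun i => hcon i
    have hie : i ∈ e.support := by
      rw [Finsupp.mem_support_iff]; omega
    have hzero : (Nat.descFactorial (d i) (e i) : ℂ) = 0 := by
      rw [Nat.descFactorial_eq_zero_iff_lt.2 hi, Nat.cast_zero]
    rw [Finset.prod_eq_zero hie hzero, mul_zero, map_zero]
  · intro hne
    rw [notMem_support_iff] at hne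
    rw [hne, mul_zero, zero_mul, map_zero]

/-! ## 2. Degree-`m` exponents as a finite type, coefficient functionals -/

section Fin

variable [Fintype σ] [DecidableEq σ]

/-- The degree-`m` exponents form a finite type. -/
instance fintypeDeg (m : ℕ) : Fintype {d : σ →₀ ℕ // d.degree = m} :=
  Fintype.subtype ((Finset.univ : Finset σ).finsuppAntidiag m) fun d => by
    simp [Finset.mem_finsuppAntidiag, Finsupp.degree_eq_sum]

/-- The linear functional `L_w(D) = Σ_{|d| = m} D_d w_d`. -/
def L (m : ℕ) (w : {d : σ →₀ ℕ // d.degree = m} → ℂ) (D : MvPolynomial σ ℂ) : ℂ :=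
  ∑ d : {d : σ →₀ ℕ // d.degree = m}, coeff d.1 D * w d

/-- The weighted coefficient vector `d ↦ g_d · d!` of `g` in degree `m`. -/
def wvec (m : ℕ) (g : MvPolynomial σ ℂ) : {d : σ →₀ ℕ // d.degree = m} → ℂ :=
  fun d => coeff d.1 g * fact d.1

/-- A sum over the support of a degree-`m` form is a sum over all degree-`m` exponents. -/
theorem sum_support_eq_sum_deg {m : ℕ} {D : MvPolynomial σ ℂ} (hD : D.IsHomogeneous m)
    (F : (σ →₀ ℕ) → ℂ) (hF : ∀ d, coeff d D = 0 → F d = 0) :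
    ∑ d ∈ D.support, F d = ∑ d : {d : σ →₀ ℕ // d.degree = m}, F d.1 := by
  classical
  have hsub : D.support ⊆ (Finset.univ : Finset σ).finsuppAntidiag m := by
    intro d hd
    have : d.degree = m := by
      rw [Finsupp.degree_eq_weight_one]; exact hD (mem_support_iff.1 hd)
    simp [Finset.mem_finsuppAntidiag, Finsupp.degree_eq_sum, ← this]
  rw [Finset.sum_subset hsub (fun d _ hd => hF d (notMem_support_iff.1 hd))]
  rw [← Finset.sum_subtype ((Finset.univ : Finset σ).finsuppAntidiag m)]
  intro d
  simp [Finset.mem_finsuppAntidiag, Finsupp.degree_eq_sum]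

/-- Pairing in functional form: `D ⌟ g = C (L_{wvec g} D)` for forms of degree `m`. -/
theorem apolarAction_eq_C_L {D g : MvPolynomial σ ℂ} {m : ℕ}
    (hD : D.IsHomogeneous m) (hg : g.IsHomogeneous m) :
    apolarAction D g = C (L m (wvec m g) D) := by
  rw [apolarAction_eq_C hD hg]
  congr 1
  unfold L wvec
  rw [sum_support_eq_sum_deg hD (fun d => coeff d D * coeff d g * fact d)
    (fun d hd => by rw [hd, zero_mul, zero_mul])]
  refine Finset.sum_congr rfl fun d _ => ?_
  ring

/-- Hence `D ∈ Ann_m(g)` iff `L_{wvec g}(D) = 0`, for forms of degree `m`. -/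
theorem apolarAction_eq_zero_iff {D g : MvPolynomial σ ℂ} {m : ℕ}
    (hD : D.IsHomogeneous m) (hg : g.IsHomogeneous m) :
    apolarAction D g = 0 ↔ L m (wvec m g) D = 0 := by
  rw [apolarAction_eq_C_L hD hg]
  exact ⟨fun h => by simpa using congrArg (coeff 0) h, fun h => by rw [h, map_zero]⟩

theorem L_smul_left {m : ℕ} (c : ℂ) (w : {d : σ →₀ ℕ // d.degree = m} → ℂ) (D : MvPolynomial σ ℂ) :
    L m (c • w) D = c * L m w D := by
  unfold L
  rw [Finset.mul_sum]
  refine Finset.sum_congr rfl fun d _ => ?_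
  simp only [Pi.smul_apply, smul_eq_mul]
  ring

theorem L_smul_poly {m : ℕ} (c : ℂ) (w : {d : σ →₀ ℕ // d.degree = m} → ℂ) (D : MvPolynomial σ ℂ) :
    L m w (c • D) = c * L m w D := by
  unfold L
  rw [Finset.mul_sum]
  refine Finset.sum_congr rfl fun d _ => ?_
  rw [coeff_smul, smul_eq_mul]
  ring

theorem L_sub_poly {m : ℕ} (w : {d : σ →₀ ℕ // d.degree = m} → ℂ) (D E : MvPolynomial σ ℂ) :
    L m w (D - E) = L m w D - L m w E := by
  unfold L
  rw [← Finset.sum_sub_distrib]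
  refine Finset.sum_congr rfl fun d _ => ?_
  rw [coeff_sub]
  ring

/-- `L_w(D)` is continuous in `w`. -/
theorem continuous_L {m : ℕ} (D : MvPolynomial σ ℂ) :
    Continuous fun w : {d : σ →₀ ℕ // d.degree = m} → ℂ => L m w D := by
  unfold L
  exact continuous_finsetSum _ fun d _ => continuous_const.mul (continuous_apply d)

/-- The polynomial with prescribed degree-`m` coefficient vector `c`. -/
def polyOf (m : ℕ) (c : {d : σ →₀ ℕ // d.degree = m} → ℂ) : MvPolynomial σ ℂ :=
  ∑ d : {d : σ →₀ ℕ // d.degree = m}, monomial d.1 (c d)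

theorem coeff_polyOf (m : ℕ) (c : {d : σ →₀ ℕ // d.degree = m} → ℂ) (d : {d : σ →₀ ℕ // d.degree = m}) :
    coeff d.1 (polyOf m c) = c d := by
  classical
  unfold polyOf
  rw [coeff_sum, Finset.sum_eq_single d]
  · rw [coeff_monomial, if_pos rfl]
  · intro e _ hne
    rw [coeff_monomial, if_neg]
    exact fun h => hne (Subtype.ext h)
  · intro h; exact absurd (Finset.mem_univ d) h

theorem polyOf_isHomogeneous (m : ℕ) (c : {d : σ →₀ ℕ // d.degree = m} → ℂ) :
    (polyOf m c).IsHomogeneous m := by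
  unfold polyOf
  refine IsHomogeneous.sum _ _ _ fun d _ => ?_
  exact isHomogeneous_monomial _ d.2

theorem L_polyOf (m : ℕ) (w c : {d : σ →₀ ℕ // d.degree = m} → ℂ) :
    L m w (polyOf m c) = ∑ d, c d * w d := by
  unfold L
  refine Finset.sum_congr rfl fun d _ => ?_
  rw [coeff_polyOf]

/-- A nonzero form of degree `m` has a nonzero weighted vector. -/
theorem wvec_ne_zero {m : ℕ} {g : MvPolynomial σ ℂ} (hg : g.IsHomogeneous m) (hne : g ≠ 0) :
    wvec m g ≠ 0 := by
  obtain ⟨d, hd⟩ := ne_zero_iff.1 hne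
  have hdeg : d.degree = m := by
    rw [Finsupp.degree_eq_weight_one]; exact hg hd
  intro h
  have := congrFun h ⟨d, hdeg⟩
  simp only [wvec, Pi.zero_apply, mul_eq_zero] at this
  rcases this with h1 | h2
  · exact hd h1
  · exact fact_ne_zero d h2

/-- **Proportionality**: if `L_v(D) = 0 ⟹ L_u(D) = 0` for all forms `D = polyOf c`, and `v ≠ 0`,
then `u = μ • v`. -/
theorem exists_smul_of_ker_le {m : ℕ} (v u : {d : σ →₀ ℕ // d.degree = m} → ℂ) (hv : v ≠ 0)
    (h : ∀ c : {d : σ →₀ ℕ // d.degree = m} → ℂ, (∑ d, c d * v d) = 0 → (∑ d, c d * u d) = 0) :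
    ∃ μ : ℂ, u = μ • v := by
  classical
  obtain ⟨d₀, hd₀⟩ : ∃ d₀, v d₀ ≠ 0 := by
    by_contra hcon; push Not at hcon; exact hv (funext hcon)
  refine ⟨u d₀ / v d₀, funext fun d => ?_⟩
  -- test vector c = v d₀ • e_d − v d • e_{d₀}
  have key := h (fun e => (if e = d then v d₀ else 0) - (if e = d₀ then v d else 0)) ?_
  · simp only [sub_mul, Finset.sum_sub_distrib, ite_mul, zero_mul, Finset.sum_ite_eq',
      Finset.mem_univ, if_true] at key
    simp only [Pi.smul_apply, smul_eq_mul]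
    field_simp
    linear_combination key
  · simp only [sub_mul, Finset.sum_sub_distrib, ite_mul, zero_mul, Finset.sum_ite_eq',
      Finset.mem_univ, if_true]
    ring

end Fin

/-! ## 3. Orbit facts for `det_m` -/

section Orbit

variable {ι : Type*} [Fintype ι] [DecidableEq ι]

/-- Elements of `GL · det` are nonzero. -/
theorem ne_zero_of_mem_glOrbit_detPoly {P : MvPolynomial (ι × ι) ℂ}
    (hP : P ∈ glOrbit (ι × ι) ℂ (detPoly ι ℂ)) : P ≠ 0 := by
  obtain ⟨g, hg⟩ := hP
  intro h
  have h' : linSubstRep (ι × ι) ℂ g (detPoly ι ℂ) = 0 := hg.trans h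
  have h2 : linSubstRep (ι × ι) ℂ g⁻¹ (linSubstRep (ι × ι) ℂ g (detPoly ι ℂ)) = detPoly ι ℂ := by
    rw [← Module.End.mul_apply, ← map_mul, inv_mul_cancel, map_one, Module.End.one_apply]
  have h3 : detPoly ι ℂ = 0 := by
    rw [← h2, h', map_zero]
  have hne : detPoly ι ℂ ≠ 0 := by
    simpa [detPoly] using Matrix.det_mvPolynomialX_ne_zero ι ℂ
  exact hne h3

/-- Elements of `GL · det` are forms of degree `card ι`. -/
theorem isHomogeneous_of_mem_glOrbit_detPoly {P : MvPolynomial (ι × ι) ℂ}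
    (hP : P ∈ glOrbit (ι × ι) ℂ (detPoly ι ℂ)) : P.IsHomogeneous (Fintype.card ι) := by
  obtain ⟨g, hg⟩ := hP
  rw [← hg]
  show (linSubstRep (ι × ι) ℂ g (detPoly ι ℂ)).IsHomogeneous (Fintype.card ι)
  rw [linSubstRep_apply]
  exact linSubst_isHomogeneous _ detPoly_isHomogeneous

/-- Row scaling: the diagonal substitution scaling the variables of row `i₀` by `c`. -/
def rowScale (i₀ : ι) (c : ℂ) : Matrix (ι × ι) (ι × ι) ℂ :=
  Matrix.diagonal fun p => if p.1 = i₀ then c else 1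

theorem linSubst_rowScale_X (i₀ : ι) (c : ℂ) (p : ι × ι) :
    linSubst (ι × ι) ℂ (rowScale i₀ c) (X p) = (if p.1 = i₀ then c else 1) • X p := by
  classical
  rw [linSubst_X, Finset.sum_eq_single p]
  · simp [rowScale]
  · intro q _ hq
    simp [rowScale, Matrix.diagonal_apply_ne _ hq]
  · intro h; exact absurd (Finset.mem_univ p) h

/-- `c • det = (row scaling) · det`, so the orbit `GL · det` is a cone. -/
theorem linSubst_rowScale_detPoly (i₀ : ι) (c : ℂ) :
    linSubst (ι × ι) ℂ (rowScale i₀ c) (detPoly ι ℂ) = c • detPoly ι ℂ := by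
  classical
  rw [detPoly, AlgHom.map_det]
  set X' : Matrix ι ι (MvPolynomial (ι × ι) ℂ) := Matrix.mvPolynomialX ι ι ℂ with hX'
  have hM : (linSubst (ι × ι) ℂ (rowScale i₀ c)).mapMatrix X' =
      Matrix.updateRow X' i₀ ((C c : MvPolynomial (ι × ι) ℂ) • (fun j => X' i₀ j)) := by
    ext i j
    rw [AlgHom.mapMatrix_apply, Matrix.map_apply, Matrix.updateRow_apply]
    simp only [hX', Matrix.mvPolynomialX_apply, linSubst_rowScale_X]
    split_ifs with h
    · subst h
      simp [smul_eq_C_mul]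
    · simp
  rw [hM, Matrix.det_updateRow_smul, show (fun j => X' i₀ j) = X' i₀ from rfl,
    Matrix.updateRow_eq_self, smul_eq_C_mul]

theorem smul_mem_glOrbit_detPoly [Nonempty ι] {P : MvPolynomial (ι × ι) ℂ}
    (hP : P ∈ glOrbit (ι × ι) ℂ (detPoly ι ℂ)) {c : ℂ} (hc : c ≠ 0) :
    c • P ∈ glOrbit (ι × ι) ℂ (detPoly ι ℂ) := by
  classical
  obtain ⟨g, hg⟩ := hP
  obtain ⟨i₀⟩ := ‹Nonempty ι›
  have hdet : (rowScale i₀ c).det ≠ 0 := by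
    rw [rowScale, Matrix.det_diagonal, Finset.prod_ne_zero_iff]
    intro p _
    split_ifs <;> simp [hc]
  refine ⟨g * Matrix.GeneralLinearGroup.mkOfDetNeZero _ hdet, ?_⟩
  rw [← hg]
  change linSubstRep (ι × ι) ℂ (g * Matrix.GeneralLinearGroup.mkOfDetNeZero _ hdet) (detPoly ι ℂ) =
    c • linSubstRep (ι × ι) ℂ g (detPoly ι ℂ)
  rw [map_mul, Module.End.mul_apply, linSubstRep_apply, linSubstRep_apply]
  change linSubst (ι × ι) ℂ (g : Matrix (ι × ι) (ι × ι) ℂ)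
      (linSubst (ι × ι) ℂ (rowScale i₀ c) (detPoly ι ℂ)) = c • linSubst (ι × ι) ℂ (g : Matrix _ _ ℂ) (detPoly ι ℂ)
  rw [linSubst_rowScale_detPoly, map_smul]

end Orbit

/-! ## 4. The padded permanent is a nonzero form -/

theorem paddedPerPoly_ne_zero (n m : ℕ) [NeZero m] : paddedPerPoly ℂ n m ≠ 0 := by
  have hinj : Function.Injective
      (fun ij : BlockIdx n m × BlockIdx n m => ((ij.1 : Fin m), (ij.2 : Fin m))) := by
    intro a b h
    simp only [Prod.mk.injEq] at h
    exact Prod.ext (Subtype.ext h.1) (Subtype.ext h.2)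
  have hper : rename (fun ij : BlockIdx n m × BlockIdx n m => ((ij.1 : Fin m), (ij.2 : Fin m)))
      (perPoly (BlockIdx n m) ℂ) ≠ 0 := by
    intro h
    apply perPoly_ne_zero (BlockIdx n m) ℂ
    exact rename_injective _ hinj (by rw [h, map_zero])
  unfold paddedPerPoly
  exact mul_ne_zero (pow_ne_zero _ (X_ne_zero _)) hper

/-! ## 5. Euclidean limits of orbit points lie in the orbit closure -/

theorem mem_orbitClosure_of_tendsto {ι : Type*} [Fintype ι] [DecidableEq ι]
    {f g : MvPolynomial ι ℂ} (Q : ℕ → MvPolynomial ι ℂ) {φ : ℕ → ℕ}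
    (hQ : ∀ t, Q t ∈ glOrbit ι ℂ f)
    (hlim : Tendsto (fun t => coeffVec (Q (φ t))) atTop (𝓝 (coeffVec g))) :
    g ∈ orbitClosure f := by
  rw [mem_orbitClosure_iff]
  intro p hp
  -- `x ↦ p(x)` is continuous in the product topology (a polynomial in finitely many coordinates)
  have hcont : Continuous fun x : (ι →₀ ℕ) → ℂ => eval x p := continuous_eval p
  have h1 : Tendsto (fun t => eval (coeffVec (Q (φ t))) p) atTop (𝓝 (eval (coeffVec g) p)) :=
    (hcont.tendsto (coeffVec g)).comp hlim
  have hae : ∀ x : (ι →₀ ℕ) → ℂ, aeval x p = eval x p := fun x => by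
    rw [aeval_def]
    rfl
  have h0 : ∀ t, eval (coeffVec (Q (φ t))) p = 0 := fun t => by
    rw [← hae]
    exact hp (Q (φ t)) (hQ (φ t))
  have h3 : Tendsto (fun _ : ℕ => (0 : ℂ)) atTop (𝓝 (eval (coeffVec g) p)) :=
    h1.congr h0
  have h4 : eval (coeffVec g) p = 0 := tendsto_nhds_unique h3 tendsto_const_nhds
  rw [hae]
  exact h4

/-! ## 6. The theorem: a witness forces membership -/

section Main

variable [Fintype σ] [DecidableEq σ]

/-- `κ(u) := Σ_d conj(u_d) u_d ≠ 0` for `u ≠ 0`. -/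
theorem sum_conj_mul_self_ne_zero {ι : Type*} [Fintype ι] {u : ι → ℂ} (hu : u ≠ 0) :
    (∑ d, conj (u d) * u d) ≠ 0 := by
  have h : (∑ d, conj (u d) * u d) = ((∑ d, ‖u d‖ ^ 2 : ℝ) : ℂ) := by
    push_cast
    refine Finset.sum_congr rfl fun d _ => ?_
    rw [Complex.conj_mul']
  rw [h]
  intro h0
  have h0' : (∑ d, ‖u d‖ ^ 2 : ℝ) = 0 := by exact_mod_cast h0
  apply hu
  funext d
  have := (Finset.sum_eq_zero_iff_of_nonneg (fun d _ => sq_nonneg ‖u d‖)).1 h0' d (Finset.mem_univ d)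
  exact norm_eq_zero.1 ((pow_eq_zero_iff two_ne_zero).1 this)

/-- **Step 1 (corrected annihilators).** Along a subsequence on which the normalised weighted
vectors `v (φ t) ∥ wvec (P (φ t))` converge to `u`, every degree-`m` form `D` with `L_u(D) = 0` is a
limit of annihilators of the `P (φ t)`, hence lies in `J m` by the limsup clause W3. [folklore] -/
theorem mem_of_L_eq_zero {m : ℕ} {P : ℕ → MvPolynomial σ ℂ} {J : ℕ → Set (MvPolynomial σ ℂ)}
    (hPhom : ∀ t, (P t).IsHomogeneous m)
    (hW3 : ∀ (D : MvPolynomial σ ℂ) (φ : ℕ → ℕ) (Ds : ℕ → MvPolynomial σ ℂ), StrictMono φ →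
      (∀ t, (Ds t).IsHomogeneous m ∧ apolarAction (Ds t) (P (φ t)) = 0) →
      Tendsto (fun t => coeffVec (Ds t)) atTop (𝓝 (coeffVec D)) → D ∈ J m)
    (v : ℕ → ({d : σ →₀ ℕ // d.degree = m} → ℂ)) (r : ℕ → ℂ)
    (hwv : ∀ t, wvec m (P t) = r t • v t)
    {u : {d : σ →₀ ℕ // d.degree = m} → ℂ} (hune : u ≠ 0) {φ : ℕ → ℕ} (hφ : StrictMono φ)
    (hlim : Tendsto (fun t => v (φ t)) atTop (𝓝 u))
    {D : MvPolynomial σ ℂ} (hD : D.IsHomogeneous m) (hLD : L m u D = 0) : D ∈ J m := by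
  classical
  obtain ⟨E, hE⟩ : ∃ E : MvPolynomial σ ℂ, E = polyOf m (fun d => conj (u d)) := ⟨_, rfl⟩
  have hEhom : E.IsHomogeneous m := hE ▸ polyOf_isHomogeneous _ _
  obtain ⟨κ, hκ⟩ : ∃ κ : ℂ, κ = L m u E := ⟨_, rfl⟩
  have hκne : κ ≠ 0 := by
    rw [hκ, hE, L_polyOf]
    exact sum_conj_mul_self_ne_zero hune
  obtain ⟨Ds, hDs⟩ : ∃ Ds : ℕ → MvPolynomial σ ℂ,
      ∀ t, Ds t = κ⁻¹ • ((L m (v (φ t)) E) • D - (L m (v (φ t)) D) • E) := ⟨_, fun t => rfl⟩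
  have hDshom : ∀ t, (Ds t).IsHomogeneous m := by
    intro t
    have hD' := (mem_homogeneousSubmodule m D).2 hD
    have hE' := (mem_homogeneousSubmodule m E).2 hEhom
    rw [hDs, ← mem_homogeneousSubmodule]
    exact Submodule.smul_mem _ _ (Submodule.sub_mem _ (Submodule.smul_mem _ _ hD')
      (Submodule.smul_mem _ _ hE'))
  refine hW3 D φ Ds hφ (fun t => ⟨hDshom t, ?_⟩) ?_
  · -- `Ds t` annihilates `P (φ t)`: its pairing with `wvec (P (φ t)) ∥ v (φ t)` vanishes
    rw [apolarAction_eq_zero_iff (hDshom t) (hPhom (φ t)), hwv, L_smul_left, hDs,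
      L_smul_poly, L_sub_poly, L_smul_poly, L_smul_poly]
    ring
  · -- `Ds t → D` coefficientwise
    have hcL : ∀ X : MvPolynomial σ ℂ, Tendsto (fun t => L m (v (φ t)) X) atTop (𝓝 (L m u X)) :=
      fun X => ((continuous_L X).tendsto u).comp hlim
    rw [tendsto_pi_nhds]
    intro d
    have hcoord : (fun t => coeffVec (Ds t) d) =
        fun t => κ⁻¹ * (L m (v (φ t)) E * coeff d D - L m (v (φ t)) D * coeff d E) := by
      funext t
      rw [hDs, coeffVec_apply, coeff_smul, coeff_sub, coeff_smul, coeff_smul]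
      simp only [smul_eq_mul]
    have hlim' : Tendsto (fun t => κ⁻¹ * (L m (v (φ t)) E * coeff d D - L m (v (φ t)) D * coeff d E))
        atTop (𝓝 (κ⁻¹ * (L m u E * coeff d D - L m u D * coeff d E))) :=
      (((hcL E).mul tendsto_const_nhds).sub ((hcL D).mul tendsto_const_nhds)).const_mul _
    rw [hcoord]
    have hval : κ⁻¹ * (L m u E * coeff d D - L m u D * coeff d E) = coeffVec D d := by
      rw [hLD, ← hκ, zero_mul, sub_zero, ← mul_assoc, inv_mul_cancel₀ hκne, one_mul, coeffVec_apply]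
    rw [← hval]
    exact hlim'

end Main

/-- **W1 ∧ W3@m ∧ W5@m ⟹ `X₀₀^{m−n} per_n ∈ Δ(det_m)`** (the mathematical content of support item
`WitnessToMembership`, stmt-5782; `3 ≤ n` is not needed, W2 and W4 are not used). [folklore] -/
theorem mem_orbitClosure_of_witness {n m : ℕ} [NeZero m] (hnm : n ≤ m)
    (P : ℕ → MvPolynomial (Fin m × Fin m) ℂ) (J : ℕ → Set (MvPolynomial (Fin m × Fin m) ℂ))
    (hW1 : ∀ t, P t ∈ glOrbit (Fin m × Fin m) ℂ (detPoly (Fin m) ℂ))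
    (hW3 : ∀ k ≤ m, ∀ (D : MvPolynomial (Fin m × Fin m) ℂ) (φ : ℕ → ℕ)
      (Ds : ℕ → MvPolynomial (Fin m × Fin m) ℂ), StrictMono φ →
      (∀ t, (Ds t).IsHomogeneous k ∧ apolarAction (Ds t) (P (φ t)) = 0) →
      Tendsto (fun t => coeffVec (Ds t)) atTop (𝓝 (coeffVec D)) → D ∈ J k)
    (hW5 : ∀ k ≤ m, ∀ D ∈ J k, apolarAction D (paddedPerPoly ℂ n m) = 0) :
    paddedPerPoly ℂ n m ∈ orbitClosure (detPoly (Fin m) ℂ) := by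
  classical
  have hPhom : ∀ t, (P t).IsHomogeneous m := fun t => by
    simpa [Fintype.card_fin] using isHomogeneous_of_mem_glOrbit_detPoly (hW1 t)
  have hPne : ∀ t, P t ≠ 0 := fun t => ne_zero_of_mem_glOrbit_detPoly (hW1 t)
  -- weighted coefficient vectors, their norms, and the normalised vectors `v t`
  have hwne : ∀ t, wvec m (P t) ≠ 0 := fun t => wvec_ne_zero (hPhom t) (hPne t)
  have hnorm : ∀ t, ‖wvec m (P t)‖ ≠ 0 := fun t => norm_ne_zero_iff.2 (hwne t)
  have hnormC : ∀ t, ((‖wvec m (P t)‖ : ℝ) : ℂ) ≠ 0 := fun t => Complex.ofReal_ne_zero.2 (hnorm t)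
  obtain ⟨v, hv⟩ : ∃ v : ℕ → ({d : (Fin m × Fin m) →₀ ℕ // d.degree = m} → ℂ),
      ∀ t, v t = ((‖wvec m (P t)‖ : ℝ) : ℂ)⁻¹ • wvec m (P t) := ⟨_, fun t => rfl⟩
  have hvs : ∀ t, v t ∈ Metric.sphere (0 : {d : (Fin m × Fin m) →₀ ℕ // d.degree = m} → ℂ) 1 := by
    intro t
    rw [mem_sphere_zero_iff_norm, hv, norm_smul, norm_inv, Complex.norm_real, norm_norm,
      inv_mul_cancel₀ (hnorm t)]
  obtain ⟨u, hu, φ, hφ, hlim⟩ := (isCompact_sphere _ _).tendsto_subseq hvs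
  have hlim1 : Tendsto (fun t => v (φ t)) atTop (𝓝 u) := hlim
  have hune : u ≠ 0 := by
    intro h
    rw [h, mem_sphere_zero_iff_norm, norm_zero] at hu
    exact zero_ne_one hu
  have hwv : ∀ t, wvec m (P t) = ((‖wvec m (P t)‖ : ℝ) : ℂ) • v t := by
    intro t
    rw [hv, smul_smul, mul_inv_cancel₀ (hnormC t), one_smul]
  -- Step 1: forms with `L_u = 0` lie in `J m`
  have key : ∀ D : MvPolynomial (Fin m × Fin m) ℂ, D.IsHomogeneous m → L m u D = 0 → D ∈ J m :=
    fun D hD hLD => mem_of_L_eq_zero hPhom (hW3 m le_rfl) v _ hwv hune hφ hlim1 hD hLD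
  -- Step 2: `L_u D = 0 ⟹ L_{w_pp} D = 0`, hence `w_pp = μ • u`
  have hpphom : (paddedPerPoly ℂ n m).IsHomogeneous m := paddedPerPoly_isHomogeneous hnm
  have himp : ∀ c : {d : (Fin m × Fin m) →₀ ℕ // d.degree = m} → ℂ,
      (∑ d, c d * u d) = 0 → (∑ d, c d * wvec m (paddedPerPoly ℂ n m) d) = 0 := by
    intro c hc
    have hD := key (polyOf m c) (polyOf_isHomogeneous m c) (by rw [L_polyOf]; exact hc)
    have h5 := hW5 m le_rfl _ hD
    rw [apolarAction_eq_zero_iff (polyOf_isHomogeneous m c) hpphom, L_polyOf] at h5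
    exact h5
  obtain ⟨μ, hμ⟩ := exists_smul_of_ker_le u _ hune himp
  have hμne : μ ≠ 0 := by
    rintro rfl
    rw [zero_smul] at hμ
    exact wvec_ne_zero hpphom (paddedPerPoly_ne_zero n m) hμ
  -- Step 3: the rescaled orbit sequence converges to `pp` coefficientwise
  obtain ⟨c, hc⟩ : ∃ c : ℕ → ℂ, ∀ t, c t = μ * ((‖wvec m (P (φ t))‖ : ℝ) : ℂ)⁻¹ :=
    ⟨_, fun t => rfl⟩
  have hcne : ∀ t, c t ≠ 0 := fun t => by
    rw [hc]; exact mul_ne_zero hμne (inv_ne_zero (hnormC (φ t)))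
  have hlim2 : Tendsto (fun t => coeffVec (c t • P (φ t))) atTop
      (𝓝 (coeffVec (paddedPerPoly ℂ n m))) := by
    rw [tendsto_pi_nhds]
    intro d
    by_cases hd : d.degree = m
    · have hvd : Tendsto (fun t => v (φ t) ⟨d, hd⟩) atTop (𝓝 (u ⟨d, hd⟩)) :=
        ((continuous_apply _).tendsto u).comp hlim1
      have h1 : (fun t => coeffVec (c t • P (φ t)) d) =
          fun t => (μ * (fact d)⁻¹) * v (φ t) ⟨d, hd⟩ := by
        funext t
        rw [coeffVec_apply, coeff_smul, smul_eq_mul, hc, hv]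
        simp only [Pi.smul_apply, smul_eq_mul, wvec]
        field_simp [fact_ne_zero d, hnormC (φ t)]
      have h2 : coeffVec (paddedPerPoly ℂ n m) d = (μ * (fact d)⁻¹) * u ⟨d, hd⟩ := by
        have := congrFun hμ ⟨d, hd⟩
        simp only [wvec, Pi.smul_apply, smul_eq_mul] at this
        rw [coeffVec_apply]
        field_simp [fact_ne_zero d]
        linear_combination this
      rw [h1, h2]
      exact hvd.const_mul _
    · have h1 : (fun t => coeffVec (c t • P (φ t)) d) = fun _ => 0 := by
        funext t
        rw [coeffVec_apply, coeff_smul, (hPhom (φ t)).coeff_eq_zero hd, smul_zero]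
      have h2 : coeffVec (paddedPerPoly ℂ n m) d = 0 := hpphom.coeff_eq_zero hd
      rw [h1, h2]
      exact tendsto_const_nhds
  -- Step 4: the rescaled sequence stays in the orbit (cone), so `pp` is in the closure
  exact mem_orbitClosure_of_tendsto (φ := id) (fun t => c t • P (φ t))
    (fun t => smul_mem_glOrbit_detPoly (hW1 _) (hcne t)) hlim2

/-- **`WitnessToMembership` (stmt-ValiantsHypothesis-5782) holds.** [folklore] -/
theorem witnessToMembership_holds : WitnessToMembership := by
  intro n m _ _ hnm act rk
  rintro ⟨P, J, h1, -, h3, -, h5⟩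
  exact mem_orbitClosure_of_witness hnm P J h1 h3 h5

end

end Summit.ValiantsHypothesis.ValiantsHypothesis.Theorems.BorderApolarityWitnessToMembership
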